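import Mathlib
import HarnessLib
import Summits.NavierStokesRegularity.NavierStokesRegularity.Theorems.WakeRatchetMinimalViscousBlowupLitMeasureEnergy

/-!
# Route `WakeRatchet`, crux `MinimalViscousBlowup` (stmt-NavierStokesRegularity-22743), LINE g11-1 «threshold ray» (skeleton v3.10
# ebed8644104749ae) — the SHELL DISSIPATION BUDGET in integral form (planner's sketched support lemma `shell_dissipation_budget_sig`,
# `bc/averaged_ceiling_sig.lean`)

Companion of the landed `litMeasure_window_le_energy` / `averagedCeiling` (Markov form).  For a regular trajectory of the NS-scaled `ν`-viscous
lattice on `[0,T)` from the one-shell datum `X₀` (cancelling table with `|α_{··(0,0,1)}| ≤ 1`), every window `(0,T']`, `T' < T`, and every shell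
`k`, the energy dissipated by shell `k` is at most the datum energy:

  `ν · λ^{2k} · ∫_{(0,T']} ‖X_k(t)‖² dt ≤ E₀ = Σ_i ½X₀ᵢ²`   (`shell_dissipation_budget_window`),

uniformly in the horizon; `shell_dissipation_budget` is the same for `ViscousGlobal` solutions on every `(0,T₀]`.  Mechanism as in the Markov
form: truncated energy identity `E_L' = −Π_{L−1} − ν Σ_{j<L} λ^{2j}‖X_j‖²` (`hasDerivWithinAt_blockEnergy`), top flux `≤ 4³M³λ^{−L}` under the
weight-10 bound (`abs_botSum_le_of_weight10`), FTC for the monotone potential `E₀ + 4³M³λ^{−L}·t − E_L(t)`, and `L → ∞`.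
MODEL lattice only (nothing about Navier–Stokes; no NS regularity statement is proved; no stub is closed by name).
`--supports stmt-NavierStokesRegularity-22743 --as helper`.
[cite: Tao2016AveragedNS, §4 proof of (4.13) (energy identity with the cancellation (4.3)), Lemma 4.1 (4.5), (4.11)]
-/

noncomputable section

set_option linter.dupNamespace false

open Set Filter Topology MeasureTheory
open Literature.Analysis.FluidPDE Literature.Analysis.FluidPDE.TaoCascade

namespace Summit.NavierStokesRegularity.NavierStokesRegularity.Theorems.MinimalViscousBlowup.ThresholdRay

/-- **Shell dissipation budget on a window.**  For a regular trajectory of the `ν`-viscous lattice on `[0,T)` from the one-shell datum `X₀`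
(cancelling table, `|α_{··(0,0,1)}| ≤ 1`), every `T' ∈ (0,T)` and every shell `k`:
`ν·λ^{2k}·∫_{(0,T']} ‖X_k(t)‖² dt ≤ Σ_i ½X₀ᵢ²`. [cite: Tao2016AveragedNS, §4 proof of (4.13), Lemma 4.1 (4.5)] -/
theorem shell_dissipation_budget_window {ε₀ ν T T' : ℝ} (hε : 0 < ε₀) (hν : 0 < ν)
    {α : Fin 4 → Fin 4 → Fin 4 → ℤ × ℤ × ℤ → ℝ} (hcan : IsCancellingCoeff α)
    (hα1 : ∀ i₁ i₂ i₃, |α i₁ i₂ i₃ (0, 0, 1)| ≤ 1) {X : Fin 4 → ℤ → ℝ → ℝ} {X₀ : Fin 4 → ℝ}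
    (hcd : ∀ i n, ContDiffOn ℝ 1 (X i n) (Ico 0 T))
    (hinit : ∀ i n, X i n 0 = if n = 0 then X₀ i else 0)
    (hlow : ∀ i n t, n < 0 → 0 ≤ t → X i n t = 0)
    (hmot : ∀ i n t, 0 ≤ t → t < T → derivWithin (X i n) (Ici 0) t =
      quadTerm ε₀ α X i n t - ν * (1 + ε₀) ^ ((2 : ℝ) * n) * X i n t)
    (hreg : ∀ T' : ℝ, 0 < T' → T' < T → ∃ M : ℝ, ∀ t : ℝ, 0 ≤ t → t ≤ T' →
      ∀ (i : Fin 4) (n : ℤ), (1 + (1 + ε₀) ^ ((10 : ℝ) * n)) * |X i n t| ≤ M)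
    (hT'0 : 0 < T') (hT'T : T' < T) (k : ℕ) :
    ν * (1 + ε₀) ^ (2 * k) * ∫ t in Ioc 0 T', ‖shellVec X k t‖ ^ 2 ≤ ∑ i : Fin 4, (1 / 2 : ℝ) * X₀ i ^ 2 := by
  have hl0 : (0 : ℝ) < 1 + ε₀ := by linarith
  have hl1 : (1 : ℝ) < 1 + ε₀ := by linarith
  set E₀ : ℝ := ∑ i : Fin 4, (1 / 2 : ℝ) * X₀ i ^ 2 with hE₀
  have hE₀0 : 0 ≤ E₀ := Finset.sum_nonneg fun i _ => by positivity
  -- the larger window `[0,T'']`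
  set T'' : ℝ := (T' + T) / 2 with hT''
  have hT'T'' : T' < T'' := by rw [hT'']; linarith
  have hT''T : T'' < T := by rw [hT'']; linarith
  have hderW := hasDerivWithinAt_window_of_clauses (ε₀ := ε₀) (ν := ν) (α := α) hcd hmot hT''T
  obtain ⟨M₀, hM₀⟩ := hreg T'' (hT'0.trans hT'T'') hT''T
  set M : ℝ := max M₀ 0 with hMdef
  have hM0 : 0 ≤ M := le_max_right _ _
  have hM : ∀ t : ℝ, 0 ≤ t → t ≤ T'' → ∀ (i : Fin 4) (n : ℤ), (1 + (1 + ε₀) ^ ((10 : ℝ) * n)) * |X i n t| ≤ M :=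
    fun t ht htT i n => (hM₀ t ht htT i n).trans (le_max_left _ _)
  set r : ℝ := (1 + ε₀)⁻¹ with hr
  have hr0 : 0 < r := by rw [hr]; exact inv_pos.2 hl0
  have hr1 : r < 1 := by rw [hr]; exact inv_lt_one_of_one_lt₀ hl1
  -- the shell-`k` dissipation density and its integrability on the window (continuity)
  set dk : ℝ → ℝ := fun t => ν * (1 + ε₀) ^ (2 * k) * ‖shellVec X k t‖ ^ 2 with hdk
  have hXc : ∀ i : Fin 4, ContinuousOn (fun t => X i k t) (Icc 0 T') := fun i =>
    ((hcd i k).continuousOn).mono fun t ht => ⟨ht.1, lt_of_le_of_lt ht.2 hT'T⟩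
  have hdkc : ContinuousOn dk (Icc 0 T') := by
    have h1 : ContinuousOn (fun t => ∑ i : Fin 4, X i k t ^ 2) (Icc 0 T') :=
      continuousOn_finsetSum _ fun i _ => (hXc i).pow 2
    have h2 : dk = fun t => ν * (1 + ε₀) ^ (2 * k) * ∑ i : Fin 4, X i k t ^ 2 := by
      funext t; rw [hdk]; dsimp only; rw [norm_shellVec_sq]
    rw [h2]
    exact continuousOn_const.mul h1
  have hdkint : IntegrableOn dk (Ioc 0 T') :=
    (hdkc.integrableOn_Icc).mono_set Ioc_subset_Icc_self
  -- MAIN STEP: for every `L > k`, `∫_{(0,T']} dk ≤ E₀ + 4³M³ r^L T'`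
  have hstep : ∀ L : ℕ, k < L → ∫ t in Ioc 0 T', dk t ≤ E₀ + (4 : ℝ) ^ 3 * M ^ 3 * r ^ L * T' := by
    intro L hkL
    have hL1 : 1 ≤ L := by omega
    set cL : ℝ := (4 : ℝ) ^ 3 * M ^ 3 * r ^ L with hcL
    have hcL0 : 0 ≤ cL := by rw [hcL]; positivity
    set EL : ℝ → ℝ := fun w => ∑ j ∈ Finset.Ico 0 L, ∑ i : Fin 4, (1 / 2 : ℝ) * X i j w ^ 2 with hEL
    set DL : ℝ → ℝ := fun u => ν * ∑ j ∈ Finset.Ico 0 L, (1 + ε₀) ^ ((2 : ℝ) * (j : ℤ)) * ∑ i : Fin 4, X i j u ^ 2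
      with hDL
    set BL : ℝ → ℝ := fun u => botSum ε₀ α X ((L : ℤ) - 1) u with hBL
    have hELder : ∀ u ∈ Icc (0 : ℝ) T'', HasDerivWithinAt EL (-BL u - DL u) (Icc 0 T'') u := by
      intro u hu
      have h := hasDerivWithinAt_blockEnergy (ε₀ := ε₀) (ν := ν) hcan (fun i j => hderW i j u hu) (Nat.zero_le L)
      have h0 : botSum ε₀ α X (((0 : ℕ) : ℤ) - 1) u = 0 := by
        rw [Nat.cast_zero, zero_sub]; exact botSum_neg_one_eq_zero hlow hu.1
      rw [h0, zero_sub] at h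
      exact h
    have hBLle : ∀ u ∈ Icc (0 : ℝ) T'', |BL u| ≤ cL := by
      intro u hu
      obtain ⟨L', hL'⟩ := Nat.exists_eq_add_of_le hL1
      have h := abs_botSum_le_of_weight10 (m := 4) hε hM0 hα1 (fun i n => hM u hu.1 hu.2 i n) L'
      have e1 : ((L : ℤ) - 1) = (L' : ℤ) := by rw [hL']; push_cast; ring
      have e2 : L' + 1 = L := by omega
      rw [hBL]; dsimp only; rw [e1]
      calc |botSum ε₀ α X (L' : ℤ) u| ≤ (4 : ℝ) ^ 3 * M ^ 3 * ((1 + ε₀)⁻¹) ^ (L' + 1) := by exact_mod_cast h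
        _ = cL := by rw [hcL, hr, e2]
    -- `dk ≤ DL` pointwise (the `k`-th term of a sum of nonnegative terms)
    have hdkDL : ∀ u, dk u ≤ DL u := by
      intro u
      have hkmem : k ∈ Finset.Ico 0 L := Finset.mem_Ico.mpr ⟨Nat.zero_le _, hkL⟩
      have hterm : (1 + ε₀) ^ ((2 : ℝ) * ((k : ℕ) : ℤ)) * ∑ i : Fin 4, X i k u ^ 2
          = (1 + ε₀) ^ (2 * k) * ‖shellVec X k u‖ ^ 2 := by
        rw [norm_shellVec_sq,
          show (2 : ℝ) * (((k : ℕ) : ℤ) : ℝ) = ((2 * k : ℕ) : ℝ) by push_cast; ring, Real.rpow_natCast]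
      have hsingle : (1 + ε₀) ^ ((2 : ℝ) * ((k : ℕ) : ℤ)) * ∑ i : Fin 4, X i k u ^ 2
          ≤ ∑ j ∈ Finset.Ico 0 L, (1 + ε₀) ^ ((2 : ℝ) * (j : ℤ)) * ∑ i : Fin 4, X i j u ^ 2 :=
        Finset.single_le_sum (f := fun j : ℕ => (1 + ε₀) ^ ((2 : ℝ) * (j : ℤ)) * ∑ i : Fin 4, X i j u ^ 2)
          (fun j _ => mul_nonneg (Real.rpow_nonneg hl0.le _) (Finset.sum_nonneg fun i _ => sq_nonneg _)) hkmem
      rw [hdk, hDL]; dsimp only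
      rw [mul_assoc, ← hterm]
      exact mul_le_mul_of_nonneg_left hsingle hν.le
    have hDL0 : ∀ u, 0 ≤ DL u := fun u =>
      le_trans (by rw [hdk]; positivity) (hdkDL u)
    -- the monotone potential
    set g : ℝ → ℝ := fun w => E₀ + cL * w - EL w with hg
    set g' : ℝ → ℝ := fun u => cL + BL u + DL u with hg'
    have hgder : ∀ u ∈ Icc (0 : ℝ) T'', HasDerivWithinAt g (g' u) (Icc 0 T'') u := by
      intro u hu
      have h1 : HasDerivWithinAt (fun w => E₀ + cL * w) cL (Icc 0 T'') u := by
        have := ((hasDerivAt_id u).const_mul cL).const_add E₀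
        simpa using this.hasDerivWithinAt
      refine (h1.sub (hELder u hu)).congr_deriv ?_
      rw [hg']; ring
    have hg'0 : ∀ u ∈ Icc (0 : ℝ) T'', 0 ≤ g' u := by
      intro u hu
      have h1 := hBLle u hu
      have h2 := hDL0 u
      rw [hg']; dsimp only
      linarith [neg_abs_le (BL u)]
    have hcont : ContinuousOn g (Icc 0 T') := by
      intro u hu
      have hu' : u ∈ Icc (0 : ℝ) T'' := ⟨hu.1, hu.2.trans hT'T''.le⟩
      exact ((hgder u hu').continuousWithinAt).mono (Icc_subset_Icc_right hT'T''.le)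
    have hderiv : ∀ u ∈ Ioo (0 : ℝ) T', HasDerivAt g (g' u) u := by
      intro u hu
      have hu' : u ∈ Icc (0 : ℝ) T'' := ⟨hu.1.le, (hu.2.trans hT'T'').le⟩
      exact (hgder u hu').hasDerivAt (Icc_mem_nhds hu.1 (hu.2.trans hT'T''))
    have hpos : ∀ u ∈ Ioo (0 : ℝ) T', 0 ≤ g' u := fun u hu => hg'0 u ⟨hu.1.le, (hu.2.trans hT'T'').le⟩
    have hint : IntegrableOn g' (Ioc 0 T') := intervalIntegral.integrableOn_deriv_of_nonneg hcont hderiv hpos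
    have hFTC : ∫ u in Ioc 0 T', g' u = g T' - g 0 := by
      rw [← intervalIntegral.integral_of_le hT'0.le]
      exact intervalIntegral.integral_eq_sub_of_hasDerivAt_of_le hT'0.le hcont hderiv
        ((intervalIntegrable_iff_integrableOn_Ioc_of_le hT'0.le).mpr hint)
    have hEL0 : EL 0 = E₀ := by
      rw [hEL, hE₀]; dsimp only
      rw [Finset.sum_eq_single_of_mem 0 (Finset.mem_Ico.mpr ⟨le_rfl, by omega⟩)]
      · simp [hinit]
      · intro j _ hj0
        simp [hinit, hj0]
    have hELT' : 0 ≤ EL T' := by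
      rw [hEL]; dsimp only
      exact Finset.sum_nonneg fun j _ => Finset.sum_nonneg fun i _ => by positivity
    have hIle : ∫ u in Ioc 0 T', g' u ≤ E₀ + cL * T' := by
      rw [hFTC, hg]; dsimp only; rw [hEL0]; linarith
    -- `∫ dk ≤ ∫ g'`
    have hmono : ∫ u in Ioc 0 T', dk u ≤ ∫ u in Ioc 0 T', g' u := by
      refine setIntegral_mono_on hdkint hint measurableSet_Ioc fun u hu => ?_
      have h1 := hdkDL u
      have h2 := hBLle u ⟨hu.1.le, hu.2.trans hT'T''.le⟩
      show dk u ≤ cL + BL u + DL u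
      linarith [neg_abs_le (BL u)]
    calc ∫ u in Ioc 0 T', dk u ≤ E₀ + cL * T' := hmono.trans hIle
      _ = E₀ + (4 : ℝ) ^ 3 * M ^ 3 * r ^ L * T' := by rw [hcL]
  -- `L → ∞`
  have hle : ∫ t in Ioc 0 T', dk t ≤ E₀ := by
    refine le_of_forall_pos_le_add fun η hη => ?_
    obtain ⟨n, hn⟩ := exists_pow_lt_of_lt_one (show 0 < η / ((4 : ℝ) ^ 3 * M ^ 3 * T' + 1) by positivity) hr1
    set L : ℕ := max n (k + 1) with hLdef
    have hkL : k < L := by omega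
    have hrL : r ^ L ≤ r ^ n := pow_le_pow_of_le_one hr0.le hr1.le (le_max_left _ _)
    have h := hstep L hkL
    have hA : 0 ≤ (4 : ℝ) ^ 3 * M ^ 3 * T' := by positivity
    have h1 : (4 : ℝ) ^ 3 * M ^ 3 * r ^ L * T' ≤ ((4 : ℝ) ^ 3 * M ^ 3 * T') * r ^ n := by
      calc (4 : ℝ) ^ 3 * M ^ 3 * r ^ L * T' = ((4 : ℝ) ^ 3 * M ^ 3 * T') * r ^ L := by ring
        _ ≤ ((4 : ℝ) ^ 3 * M ^ 3 * T') * r ^ n := mul_le_mul_of_nonneg_left hrL hA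
    have h2 : ((4 : ℝ) ^ 3 * M ^ 3 * T') * r ^ n ≤ ((4 : ℝ) ^ 3 * M ^ 3 * T' + 1) * (η / ((4 : ℝ) ^ 3 * M ^ 3 * T' + 1)) :=
      mul_le_mul (by linarith) hn.le (pow_nonneg hr0.le _) (by positivity)
    have h3 : ((4 : ℝ) ^ 3 * M ^ 3 * T' + 1) * (η / ((4 : ℝ) ^ 3 * M ^ 3 * T' + 1)) = η := by field_simp
    linarith
  -- pull the constant out of the integral
  have hconst : ∫ t in Ioc 0 T', dk t = ν * (1 + ε₀) ^ (2 * k) * ∫ t in Ioc 0 T', ‖shellVec X k t‖ ^ 2 := by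
    rw [hdk]; exact integral_const_mul _ _
  rw [← hconst]
  exact hle

/-- **Shell dissipation budget for global solutions.**  For a global regular `ν`-viscous solution from `X₀` (`ViscousGlobal`; cancelling table,
`|α_{··(0,0,1)}| ≤ 1`), every horizon `T₀ > 0` and shell `k`: `ν·λ^{2k}·∫_{(0,T₀]} ‖X_k(t)‖² dt ≤ Σ_i ½X₀ᵢ²` — uniformly in `T₀`.
[cite: Tao2016AveragedNS, §4 proof of (4.13), Lemma 4.1 (4.5)] -/
theorem shell_dissipation_budget {ε₀ ν : ℝ} (hε : 0 < ε₀) (hν : 0 < ν)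
    {α : Fin 4 → Fin 4 → Fin 4 → ℤ × ℤ × ℤ → ℝ} (hcan : IsCancellingCoeff α)
    (hα1 : ∀ i₁ i₂ i₃, |α i₁ i₂ i₃ (0, 0, 1)| ≤ 1) {X₀ : Fin 4 → ℝ} {X : Fin 4 → ℤ → ℝ → ℝ}
    (hX : ViscousGlobal ε₀ ν α X₀ X) {T₀ : ℝ} (hT₀ : 0 < T₀) (k : ℕ) :
    ν * (1 + ε₀) ^ (2 * k) * ∫ t in Ioc 0 T₀, ‖shellVec X k t‖ ^ 2 ≤ ∑ i : Fin 4, (1 / 2 : ℝ) * X₀ i ^ 2 := by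
  set T : ℝ := T₀ + 1 with hT
  have hT₀T : T₀ < T := by rw [hT]; linarith
  have hcd : ∀ i n, ContDiffOn ℝ 1 (X i n) (Ico 0 T) := fun i n => (hX.contDiffOn i n).mono fun t ht => ht.1
  have hreg : ∀ T' : ℝ, 0 < T' → T' < T → ∃ M : ℝ, ∀ t : ℝ, 0 ≤ t → t ≤ T' →
      ∀ (i : Fin 4) (n : ℤ), (1 + (1 + ε₀) ^ ((10 : ℝ) * n)) * |X i n t| ≤ M := by
    intro T' hT' _
    obtain ⟨M, hM⟩ := hX.apriori T' hT'
    exact ⟨M, fun t ht htT i n => hM t ⟨ht, htT⟩ i n⟩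
  exact shell_dissipation_budget_window hε hν hcan hα1 hcd hX.init hX.noLow
    (fun i n t ht _ => hX.motion i n t ht) hreg hT₀ hT₀T k

end Summit.NavierStokesRegularity.NavierStokesRegularity.Theorems.MinimalViscousBlowup.ThresholdRay

end
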